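import Summits.Ventures.GridStability.Models.WSCC9SPPointConvergence
import Literature.MathematicalPhysics.PowerSystems.StructurePreservingNonMinimumInstability
import HarnessLib

/-!
# GridStability/Models/WSCC9SPSaddlesUnstable — «#154-cand G2.b-WSCC9SP-SADDLES-255-THM» (lead g9 RULING 9cv (2)(a);
# statements and proofs PREPARED BY gridfusion-lit-1 g11 — template `HOME/lean/lit-1/templates/WSCC9SPSaddlesUnstable.lean`
# 176b4e33b0bbe218, filed by gridfusion-model-1 g8; the record `Models/WSCC9SP.lean` is model-2's):
# 255 of the 256 synchronous states per period of the WSCC9-SP9 post-fault-B record are UNSTABLE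
# synchronous solutions of the structure-preserving model, for EVERY damping vector `D > 0`

Ingredients (all on tree): `Models/WSCC9SP.lean` (record: `b`, `δ₀ = 2·arctan t`, `parentV`, `depthV`,
`b_symm`, `window`, `theta_bounds`, `isSyncEquilibrium`), `Models/WSCC9SPPointConvergence.lean`
(p573401 + p578288: `depthV_parentV`, `b_support`, `b_parentV_ne_zero`, `b_parentV_pos`, `M_nonneg`,
`edgeFlow_lt`, `ncard_pinned_syncEquilibria` = 256), lit-1
`Literature/MathematicalPhysics/PowerSystems/StructurePreservingNonMinimumInstability.lean` (p579503 +
p580311: `BergenHill.unstable_syncSolution_of_neg_branch_of_tree`, `BergenHill.ncard_unstable_syncStates_of_tree`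
— MTW2017 Cor. 2 «2^{N−1} − 1 are unstable» for the structure-preserving motions, energy route).
[cite: ManikTimmeWitthaut2017, §5.2 Cor. 2; Padiyar2013, §3.2 eqs (3.2)–(3.5)].
THREE COLUMNS: CERTIFIED for MODEL MV-3 record WSCC9-SP9 post-B (tokens of `WSCC9SP.lean`), every
`D > 0`: 255 of the 256 pinned synchronous states per period are UNSTABLE synchronous solutions
(energy route: `U` not a local minimum ⇒ from bus angles arbitrarily close on the momentum leaf with
the rotors at `ω₀` the motion departs from `(θe + ω₀t𝟙, ω₀𝟙)` by more than a fixed `ε`); the 256th is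
★ #143's cohesive `δ₀`; VALIDATED nothing numerical; MODELLED as the record — «unstable» = the
synchronous solution of MODEL M, never the grid; Table-type (type-1/type-2) labels are spectral and
NOT certified here. Nothing here says the WSCC system is stable or unstable.
-/

noncomputable section

open Real Set Filter Topology Finset

namespace Summit.Ventures.GridStability.Models.WSCC9SP

open StructurePreserving StructurePreserving.Params
open Literature.MathematicalPhysics.PowerSystems
open Literature.MathematicalPhysics.PowerSystems.ClassicalModel

/-- The BFS root G1 (idx 6) is its own parent. -/
theorem parentV_root : parentV 6 = 6 := by decide

/-- The record's equilibrium is pinned at G1: `δ₀ 6 = 2·arctan 0 = 0`. -/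
theorem δ₀_root : δ₀ 6 = 0 := by
  simp [δ₀, halfAngle, t, tV1Q]

/-- `δ₀` lies in the half-open period box (`|2·arctan tᵢ| < π`). -/
theorem δ₀_mem_Ico (i : Fin 9) : δ₀ i ∈ Set.Ico (-π) π := by
  have h1 := Real.arctan_lt_pi_div_two (t i)
  have h2 := Real.neg_pi_div_two_lt_arctan (t i)
  simp only [δ₀, halfAngle, Set.mem_Ico]
  constructor <;> linarith

/-- `δ₀` is a synchronous state of the Literature record (`flow δ₀ = P̄`; `ω₀ = 0` here). -/
theorem δ₀_sync (D : Fin 9 → ℝ) :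
    ∀ k, (params D).toBergenHill.flow δ₀ k = (params D).toBergenHill.shiftedInjection k :=
  fun k => isSyncEquilibrium D k

/-- `δ₀` is phase-cohesive on the tree: every branch angle is `≤ θ < π/2`, so every tree-edge cosine
is nonnegative (indeed positive). -/
theorem δ₀_cohesive : ∀ i : Fin 9, i ≠ 6 → 0 ≤ Real.cos (δ₀ i - δ₀ (parentV i)) := by
  intro i hi
  have hw : |δ₀ i - δ₀ (parentV i)| ≤ θ :=
    window (fun _ => 1) i (parentV i) (by rw [params_b]; exact (b_parentV_ne_zero i hi))
  have hθ := theta_bounds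
  refine Real.cos_nonneg_of_mem_Icc ⟨?_, ?_⟩
  · linarith [(abs_le.mp hw).1]
  · linarith [(abs_le.mp hw).2]

/-- ★ **EVERY SYNCHRONOUS STATE WITH A NEGATIVE-COSINE TREE LINE IS AN UNSTABLE SYNCHRONOUS
SOLUTION** (MODEL MV-3, record WSCC9-SP9 post-B, every `D > 0`): for any bus-angle vector `θe` with
`f(θe) = P̄` and `cos(θeᵢ − θe_{parent i}) < 0` on some tree line, `∃ ε > 0 ∀ r > 0 ∃ θ₁` with
`dist(θ₁, θe) < r` on the level `Σ Dₖθ₁ₖ = Σ Dₖθeₖ` such that EVERY forward solution of the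
Bergen–Hill equations with `δ(0) = θ₁` and the rotors at `ω₀` (`= 0` here) satisfies
`dist((δ(t), v(t)), (θe + ω₀t𝟙, ω₀𝟙)) > ε` at some `t ≥ 0`
(`BergenHill.unstable_syncSolution_of_neg_branch_of_tree`, hypothesis-free on the radial record). -/
theorem unstable_syncSolution_of_neg_branch {D : Fin 9 → ℝ} (hD : ∀ i, 0 < D i)
    {θe : Fin 9 → ℝ}
    (he : ∀ k, (params D).toBergenHill.flow θe k = (params D).toBergenHill.shiftedInjection k)
    {i : Fin 9} (hi : i ≠ 6) (hneg : Real.cos (θe i - θe (parentV i)) < 0) :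
    ∃ ε > 0, ∀ r > 0, ∃ θ₁ : Fin 9 → ℝ, dist θ₁ θe < r ∧
      ∑ k, (params D).toBergenHill.D k * θ₁ k = ∑ k, (params D).toBergenHill.D k * θe k ∧
      ∀ δ v : ℝ → Fin 9 → ℝ, δ 0 = θ₁ →
        (∀ k, (params D).toBergenHill.M k ≠ 0 → v 0 k = (params D).toBergenHill.syncFrequency) →
        (∀ t, 0 ≤ t → (params D).toBergenHill.IsSolutionAt δ v t) →
        ∃ t, 0 ≤ t ∧ ε < dist ((δ t, v t) : (Fin 9 → ℝ) × (Fin 9 → ℝ))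
          ((fun k => θe k + (params D).toBergenHill.syncFrequency * t),
            fun _ => (params D).toBergenHill.syncFrequency) :=
  BergenHill.unstable_syncSolution_of_neg_branch_of_tree (S := (params D).toBergenHill)
    (fun i j => b_symm i j) (M_nonneg D) hD parentV_root depthV_parentV b_support b_parentV_pos
    he hi hneg

/-- ★★ **«255 OF THE 256 ARE UNSTABLE»** (MODEL MV-3, record WSCC9-SP9 post-B, EVERY `D > 0`): the
pinned synchronous states of the half-open period box `[−π, π)⁹` other than the record's cohesive
`δ₀` number EXACTLY 255 (`= 2⁸ − 1`, with `ncard_pinned_syncEquilibria` = 256), and EVERY ONE of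
them is an unstable synchronous solution in the sense of `unstable_syncSolution_of_neg_branch`
(`BergenHill.ncard_unstable_syncStates_of_tree`; the branch pattern determines the state, so every
state `≠ δ₀` has a negative-cosine tree line). The stability of `δ₀` itself is ★ #104 / ★ #143's
energy-well / point-convergence object, not this theorem. -/
theorem ncard_unstable_syncStates {D : Fin 9 → ℝ} (hD : ∀ i, 0 < D i) :
    ({δ : Fin 9 → ℝ | δ 6 = 0 ∧ (∀ i, δ i ∈ Set.Ico (-π) π) ∧
        ∀ k, (params D).toBergenHill.flow δ k = (params D).toBergenHill.shiftedInjection k}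
        \ {δ₀}).ncard = 255 ∧
      ∀ θe ∈ {δ : Fin 9 → ℝ | δ 6 = 0 ∧ (∀ i, δ i ∈ Set.Ico (-π) π) ∧
          ∀ k, (params D).toBergenHill.flow δ k = (params D).toBergenHill.shiftedInjection k} \ {δ₀},
        ∃ ε > 0, ∀ r > 0, ∃ θ₁ : Fin 9 → ℝ, dist θ₁ θe < r ∧
          ∑ k, (params D).toBergenHill.D k * θ₁ k = ∑ k, (params D).toBergenHill.D k * θe k ∧
          ∀ δ v : ℝ → Fin 9 → ℝ, δ 0 = θ₁ →
            (∀ k, (params D).toBergenHill.M k ≠ 0 → v 0 k = (params D).toBergenHill.syncFrequency) →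
            (∀ t, 0 ≤ t → (params D).toBergenHill.IsSolutionAt δ v t) →
            ∃ t, 0 ≤ t ∧ ε < dist ((δ t, v t) : (Fin 9 → ℝ) × (Fin 9 → ℝ))
              ((fun k => θe k + (params D).toBergenHill.syncFrequency * t),
                fun _ => (params D).toBergenHill.syncFrequency) := by
  have hcons : ∀ i, (params D).toBergenHill.shiftedInjection i =
      (if i ≠ 6 then b i (parentV i) * Real.sin (δ₀ i - δ₀ (parentV i)) else 0)
        - ∑ j ∈ Finset.univ.filter (fun j => j ≠ 6 ∧ parentV j = i),
            b j (parentV j) * Real.sin (δ₀ j - δ₀ (parentV j)) := by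
    intro i
    have h := isSyncEquilibrium D i
    rw [← RadialNetwork.flow_eq_treeFlow depthV_parentV b b_symm b_support δ₀ i]
    exact h.symm
  have h := BergenHill.ncard_unstable_syncStates_of_tree (S := (params D).toBergenHill)
    (fun i j => b_symm i j) (M_nonneg D) hD parentV_root (by decide : depthV 6 = 0) depthV_parentV
    b_support b_parentV_pos (fun i => b i (parentV i) * Real.sin (δ₀ i - δ₀ (parentV i))) hcons
    edgeFlow_lt δ₀_root δ₀_mem_Ico (δ₀_sync D) δ₀_cohesive
  rw [show (2 : ℕ) ^ (9 - 1) - 1 = 255 by norm_num] at h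
  exact h

end Summit.Ventures.GridStability.Models.WSCC9SP

end
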